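import Mathlib
import Summits.ValiantsHypothesis.ValiantsHypothesis.Theorems.RigidityForcesSymmetryRankRigidMinimalReprLaplaceFiveStarLemmaK

/-!
# ValiantsHypothesis / RigidityForcesSymmetry — crux `LaplaceOptimalFive` (stmt-ValiantsHypothesis-24813), crux idea
`young-shadow` (K1) on the star: **LEMMA 2′ FOR A CLOSED TWO-TERM LETTER TENSOR (T1 / T2 / degenerate), from LEMMA K**
(memo `NOTE-p4g15-24813-K1-star.md` §4/§12; referee note `NOTE-crit3g5-24813-Lemma2prime-elementary.md` §B «LEMMA 2′ follows»)

A two-term letter tensor `H = U₁⊗W₁ + U₂⊗W₂` (`U_i` independent symmetric quadrics, `W_i` symmetric cubics) satisfying the exchange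
identity `(C_H)` (closedness; ✓ `star_shadow_exchange` for every star shadow).  ✓ `wedge_minors_poly` gives `dK_i ∧ dQ₁ ∧ dQ₂ = 0` for
BOTH cubics, and ✓ `lemmaK` applied twice yields (`lemma_two_prime`):

* (T2) the pencil is BINARY, `U_i ∈ Sym²⟨e,f⟩`, and BOTH `W₁, W₂ ∈ Sym³⟨e,f⟩` (annihilated by `⟨e,f⟩^⊥`); or
* (T1) a SQUARE member `s U₁ + t U₂ = λλᵀ` and BOTH `K₁, K₂ ∈ L·⟨Q₁, Q₂⟩` (two squares in a pencil are proportional or span a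
  binary pencil: `binary_of_two_squares`, `sq_parallel_of_dependent`); or
* (degenerate) `K₁ = 0` or `K₂ = 0` (then `H` is a single closed term — ✓ `rankOne_closed` territory).

No star hypotheses, no definitions, no `sorry`.  Honest framing: helper (L2 ⟹ the shape part of LEMMA 2′; the explicit T1 normal form
`E = 3βℓ PᵀQP` of memo §4 and the assembly (L3)/(L1) remain); K1-on-the-star PAPER PASS, not kernel; `LaplaceOptimalFive`
OPEN · CONTESTED 72/120; `VP ≠ VNP` NOT proved.
-/

set_option linter.dupNamespace false

namespace Summit.ValiantsHypothesis.ValiantsHypothesis.Theorems.RigidityForcesSymmetryRankRigidMinimalRepr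

namespace LaplaceFiveStar

open Finset MvPolynomial

/-- Two INDEPENDENT square members `λλᵀ`, `λ'λ'ᵀ` span the pencil: every column of `U₁, U₂` lies in `⟨λ, λ'⟩` (binary). [folklore] -/
theorem binary_of_two_squares (U₁ U₂ : Fin 5 → Fin 5 → ℂ) (lam lam' : Fin 5 → ℂ) (s t s' t' : ℂ)
    (hsq : ∀ x w : Fin 5, s * U₁ x w + t * U₂ x w = lam x * lam w)
    (hsq' : ∀ x w : Fin 5, s' * U₁ x w + t' * U₂ x w = lam' x * lam' w) (hD : s * t' - s' * t ≠ 0) (d : Fin 5) :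
    (∃ a b : ℂ, ∀ x : Fin 5, U₁ x d = a * lam x + b * lam' x) ∧ (∃ a b : ℂ, ∀ x : Fin 5, U₂ x d = a * lam x + b * lam' x) := by
  constructor
  · refine ⟨t' * lam d / (s * t' - s' * t), -(t * lam' d) / (s * t' - s' * t), fun x => ?_⟩
    rw [div_mul_eq_mul_div, div_mul_eq_mul_div, ← add_div, eq_div_iff hD]
    linear_combination t' * hsq x d - t * hsq' x d
  · refine ⟨-(s' * lam d) / (s * t' - s' * t), s * lam' d / (s * t' - s' * t), fun x => ?_⟩
    rw [div_mul_eq_mul_div, div_mul_eq_mul_div, ← add_div, eq_div_iff hD]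
    linear_combination -(s' * hsq x d) + s * hsq' x d

/-- Two PROPORTIONAL square members: if `(s,t) ∥ (s',t')` then `λ' = ρ λ` with `ρ ≠ 0` (given independence of `U₁, U₂`). [folklore] -/
theorem sq_parallel_of_dependent (U₁ U₂ : Fin 5 → Fin 5 → ℂ)
    (hind : ∀ s t : ℂ, (∀ x w : Fin 5, s * U₁ x w + t * U₂ x w = 0) → s = 0 ∧ t = 0)
    (lam lam' : Fin 5 → ℂ) (s t s' t' : ℂ) (hst : s ≠ 0 ∨ t ≠ 0) (hst' : s' ≠ 0 ∨ t' ≠ 0)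
    (hsq : ∀ x w : Fin 5, s * U₁ x w + t * U₂ x w = lam x * lam w)
    (hsq' : ∀ x w : Fin 5, s' * U₁ x w + t' * U₂ x w = lam' x * lam' w) (hD : s * t' - s' * t = 0) :
    ∃ ρ : ℂ, ρ ≠ 0 ∧ ∀ x : Fin 5, lam' x = ρ * lam x := by
  -- `(s',t') = κ (s,t)` with `κ ≠ 0`
  obtain ⟨κ, hκ0, hs', ht'⟩ : ∃ κ : ℂ, κ ≠ 0 ∧ s' = κ * s ∧ t' = κ * t := by
    rcases hst with hs | ht
    · refine ⟨s' / s, ?_, ?_, ?_⟩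
      · intro h
        rw [div_eq_zero_iff] at h
        rcases h with h | h
        · rcases hst' with h' | h'
          · exact h' h
          · apply h'
            have : s * t' = 0 := by linear_combination hD + t * h
            exact (mul_eq_zero.mp this).resolve_left hs
        · exact hs h
      · rw [div_mul_cancel₀ _ hs]
      · rw [div_mul_eq_mul_div, eq_div_iff hs]; linear_combination hD
    · refine ⟨t' / t, ?_, ?_, ?_⟩
      · intro h
        rw [div_eq_zero_iff] at h
        rcases h with h | h
        · rcases hst' with h' | h'
          · apply h'
            have : s' * t = 0 := by linear_combination -hD + s * h
            exact (mul_eq_zero.mp this).resolve_right ht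
          · exact h' h
        · exact ht h
      · rw [div_mul_eq_mul_div, eq_div_iff ht]; linear_combination -hD
      · rw [div_mul_cancel₀ _ ht]
  -- `λ'λ'ᵀ = κ λλᵀ`
  have hll : ∀ x w : Fin 5, lam' x * lam' w = κ * (lam x * lam w) := fun x w => by
    rw [← hsq' x w, ← hsq x w, hs', ht']; ring
  -- `λ ≠ 0`
  obtain ⟨x₀, hx₀⟩ : ∃ x₀ : Fin 5, lam x₀ ≠ 0 := by
    by_contra h
    simp only [not_exists, not_not] at h
    obtain ⟨hs, ht⟩ := hind s t fun x w => by rw [hsq x w, h x, zero_mul]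
    rcases hst with h' | h'
    · exact h' hs
    · exact h' ht
  have hx₀' : lam' x₀ ≠ 0 := by
    intro h
    have h1 := hll x₀ x₀
    rw [h, mul_zero] at h1
    have : κ = 0 := by
      have h2 : κ * (lam x₀ * lam x₀) = 0 := h1.symm
      exact (mul_eq_zero.mp h2).resolve_right (mul_ne_zero hx₀ hx₀)
    exact hκ0 this
  refine ⟨lam' x₀ / lam x₀, div_ne_zero hx₀' hx₀, fun x => ?_⟩
  rw [div_mul_eq_mul_div, eq_div_iff hx₀]
  have h1 := hll x x₀
  have h2 := hll x₀ x₀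
  -- λ'_x λ'_{x₀} = κ λ_x λ_{x₀} and λ'_{x₀}² = κ λ_{x₀}² ⟹ λ'_x λ_{x₀} = λ'_{x₀} λ_x
  have h3 : (lam' x * lam x₀ - lam' x₀ * lam x) * lam' x₀ = 0 := by
    linear_combination (lam x₀) * h1 - (lam x) * h2
  have h4 := (mul_eq_zero.mp h3).resolve_right hx₀'
  linear_combination h4

/-- **LEMMA 2′ (shape part) for a closed two-term letter tensor.**  `U₁, U₂` independent symmetric, `W₁, W₂` symmetric, exchange identity
`(C_H)` for `H = U₁⊗W₁ + U₂⊗W₂`.  Then (T2) binary pencil with both cubics in `Sym³⟨e,f⟩`, or (T1) a square member `λλᵀ` with both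
`K_i ∈ L·⟨Q₁,Q₂⟩`, or one of the cubics vanishes. [folklore] -/
theorem lemma_two_prime (U₁ U₂ : Fin 5 → Fin 5 → ℂ) (W₁ W₂ : Fin 5 → Fin 5 → Fin 5 → ℂ)
    (hU1 : ∀ a b : Fin 5, U₁ a b = U₁ b a) (hU2 : ∀ a b : Fin 5, U₂ a b = U₂ b a)
    (hW1a : ∀ a b c : Fin 5, W₁ a b c = W₁ b a c) (hW1b : ∀ a b c : Fin 5, W₁ a b c = W₁ a c b)
    (hW2a : ∀ a b c : Fin 5, W₂ a b c = W₂ b a c) (hW2b : ∀ a b c : Fin 5, W₂ a b c = W₂ a c b)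
    (hind : ∀ s t : ℂ, (∀ x w : Fin 5, s * U₁ x w + t * U₂ x w = 0) → s = 0 ∧ t = 0)
    (hC : ∀ A B C D E : Fin 5,
      (U₁ A C * W₁ B D E + U₁ A D * W₁ B C E + U₁ A E * W₁ B C D)
        + (U₂ A C * W₂ B D E + U₂ A D * W₂ B C E + U₂ A E * W₂ B C D)
      = (U₁ B C * W₁ A D E + U₁ B D * W₁ A C E + U₁ B E * W₁ A C D)
        + (U₂ B C * W₂ A D E + U₂ B D * W₂ A C E + U₂ B E * W₂ A C D))
    (Q₁ Q₂ K₁ K₂ : MvPolynomial (Fin 5) ℂ)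
    (hQ₁ : Q₁ = ∑ a : Fin 5, ∑ b : Fin 5, C (U₁ a b) * X a * X b)
    (hQ₂ : Q₂ = ∑ a : Fin 5, ∑ b : Fin 5, C (U₂ a b) * X a * X b)
    (hK₁ : K₁ = ∑ a : Fin 5, ∑ b : Fin 5, ∑ c : Fin 5, C (W₁ a b c) * X a * X b * X c)
    (hK₂ : K₂ = ∑ a : Fin 5, ∑ b : Fin 5, ∑ c : Fin 5, C (W₂ a b c) * X a * X b * X c) :
    (∃ e f : Fin 5 → ℂ,
      (∀ d : Fin 5, (∃ s t : ℂ, ∀ x : Fin 5, U₁ x d = s * e x + t * f x) ∧ (∃ s t : ℂ, ∀ x : Fin 5, U₂ x d = s * e x + t * f x)) ∧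
      (∀ v : Fin 5 → ℂ, ∑ x : Fin 5, v x * e x = 0 → ∑ x : Fin 5, v x * f x = 0 → ∀ b c : Fin 5, ∑ a : Fin 5, v a * W₁ a b c = 0) ∧
      (∀ v : Fin 5 → ℂ, ∑ x : Fin 5, v x * e x = 0 → ∑ x : Fin 5, v x * f x = 0 → ∀ b c : Fin 5, ∑ a : Fin 5, v a * W₂ a b c = 0)) ∨
    (∃ lam : Fin 5 → ℂ, ∃ s t : ℂ, (s ≠ 0 ∨ t ≠ 0) ∧ (∀ x w : Fin 5, s * U₁ x w + t * U₂ x w = lam x * lam w) ∧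
      (∃ c₁ c₂ : ℂ, K₁ = (∑ z : Fin 5, lam z • (X z : MvPolynomial (Fin 5) ℂ)) * (C c₁ * Q₁ + C c₂ * Q₂)) ∧
      (∃ c₁ c₂ : ℂ, K₂ = (∑ z : Fin 5, lam z • (X z : MvPolynomial (Fin 5) ℂ)) * (C c₁ * Q₁ + C c₂ * Q₂))) ∨
    K₁ = 0 ∨ K₂ = 0 := by
  classical
  -- the two minor conditions
  have hT₁ : ∀ a b c : Fin 5,
      pderiv a K₁ * (pderiv b Q₁ * pderiv c Q₂ - pderiv c Q₁ * pderiv b Q₂)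
        - pderiv b K₁ * (pderiv a Q₁ * pderiv c Q₂ - pderiv c Q₁ * pderiv a Q₂)
        + pderiv c K₁ * (pderiv a Q₁ * pderiv b Q₂ - pderiv b Q₁ * pderiv a Q₂) = 0 := by
    intro a b c
    rw [hQ₁, hQ₂, hK₁]
    exact wedge_minors_poly U₁ U₂ W₁ W₂ hU1 hU2 hW1a hW1b hW2b hC a b c
  have hC' : ∀ A B C D E : Fin 5,
      (U₂ A C * W₂ B D E + U₂ A D * W₂ B C E + U₂ A E * W₂ B C D)
        + (U₁ A C * W₁ B D E + U₁ A D * W₁ B C E + U₁ A E * W₁ B C D)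
      = (U₂ B C * W₂ A D E + U₂ B D * W₂ A C E + U₂ B E * W₂ A C D)
        + (U₁ B C * W₁ A D E + U₁ B D * W₁ A C E + U₁ B E * W₁ A C D) := fun A B C D E => by
    linear_combination hC A B C D E
  have hT₂ : ∀ a b c : Fin 5,
      pderiv a K₂ * (pderiv b Q₁ * pderiv c Q₂ - pderiv c Q₁ * pderiv b Q₂)
        - pderiv b K₂ * (pderiv a Q₁ * pderiv c Q₂ - pderiv c Q₁ * pderiv a Q₂)
        + pderiv c K₂ * (pderiv a Q₁ * pderiv b Q₂ - pderiv b Q₁ * pderiv a Q₂) = 0 := by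
    intro a b c
    have h := wedge_minors_poly U₂ U₁ W₂ W₁ hU2 hU1 hW2a hW2b hW1b hC' a b c
    rw [hQ₁, hQ₂, hK₂]
    simp only at h
    linear_combination -h
  obtain ⟨a₀, c₀, h0⟩ := exists_minor_ne_zero U₁ U₂ hU1 hU2 hind Q₁ Q₂ hQ₁ hQ₂
  -- binary pencils settle both cubics at once
  have binary_case : ∀ e f : Fin 5 → ℂ,
      (∀ d : Fin 5, (∃ s t : ℂ, ∀ x : Fin 5, U₁ x d = s * e x + t * f x) ∧ (∃ s t : ℂ, ∀ x : Fin 5, U₂ x d = s * e x + t * f x)) →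
      (∀ v : Fin 5 → ℂ, ∑ x : Fin 5, v x * e x = 0 → ∑ x : Fin 5, v x * f x = 0 → ∀ b c : Fin 5, ∑ a : Fin 5, v a * W₁ a b c = 0) ∧
      (∀ v : Fin 5 → ℂ, ∑ x : Fin 5, v x * e x = 0 → ∑ x : Fin 5, v x * f x = 0 → ∀ b c : Fin 5, ∑ a : Fin 5, v a * W₂ a b c = 0) :=
    fun e f hcol =>
      ⟨fun v hve hvf b c => cubic_annihilated_of_binary U₁ U₂ W₁ hU1 hU2 hW1a hW1b Q₁ Q₂ K₁ hQ₁ hQ₂ hK₁ hT₁ a₀ c₀ h0 e f hcol v hve hvf b c,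
       fun v hve hvf b c => cubic_annihilated_of_binary U₁ U₂ W₂ hU1 hU2 hW2a hW2b Q₁ Q₂ K₂ hQ₁ hQ₂ hK₂ hT₂ a₀ c₀ h0 e f hcol v hve hvf b c⟩
  rcases lemmaK U₁ U₂ W₁ hU1 hU2 hW1a hW1b hind Q₁ Q₂ K₁ hQ₁ hQ₂ hK₁ hT₁ with ⟨e, f, hcol, -⟩ | ⟨lam, s, t, hst, hsq, hK1form⟩ | hz
  · exact Or.inl ⟨e, f, hcol, binary_case e f hcol⟩
  · rcases lemmaK U₁ U₂ W₂ hU1 hU2 hW2a hW2b hind Q₁ Q₂ K₂ hQ₁ hQ₂ hK₂ hT₂ with ⟨e, f, hcol, -⟩ | ⟨lam', s', t', hst', hsq', hK2form⟩ | hz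
    · exact Or.inl ⟨e, f, hcol, binary_case e f hcol⟩
    · by_cases hD : s * t' - s' * t = 0
      · -- proportional squares: the same `λ` up to a non-zero scalar
        obtain ⟨ρ, hρ, hlam'⟩ := sq_parallel_of_dependent U₁ U₂ hind lam lam' s t s' t' hst hst' hsq hsq' hD
        obtain ⟨d₁, d₂, hK2⟩ := hK2form
        refine Or.inr (Or.inl ⟨lam, s, t, hst, hsq, hK1form, ρ * d₁, ρ * d₂, ?_⟩)
        rw [hK2]
        have hL : (∑ z : Fin 5, lam' z • (X z : MvPolynomial (Fin 5) ℂ)) = C ρ * ∑ z : Fin 5, lam z • (X z : MvPolynomial (Fin 5) ℂ) := by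
          rw [Finset.mul_sum]
          exact Finset.sum_congr rfl fun z _ => by rw [hlam' z, smul_eq_C_mul, smul_eq_C_mul, map_mul, mul_assoc]
        rw [hL, map_mul, map_mul]
        ring
      · -- independent squares: binary in `⟨λ, λ'⟩`
        have hcol : ∀ d : Fin 5, (∃ a b : ℂ, ∀ x : Fin 5, U₁ x d = a * lam x + b * lam' x) ∧
            (∃ a b : ℂ, ∀ x : Fin 5, U₂ x d = a * lam x + b * lam' x) :=
          fun d => binary_of_two_squares U₁ U₂ lam lam' s t s' t' hsq hsq' hD d
        exact Or.inl ⟨lam, lam', hcol, binary_case lam lam' hcol⟩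
    · exact Or.inr (Or.inr (Or.inr hz))
  · exact Or.inr (Or.inr (Or.inl hz))

end LaplaceFiveStar

end Summit.ValiantsHypothesis.ValiantsHypothesis.Theorems.RigidityForcesSymmetryRankRigidMinimalRepr
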